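/-
Copyright (c) 2026 the pub-hodgecm-mathlib formalisation cell (harness21).  Prover seat hodgecm-mathlib-K2E5-p04 (g3), HCML Track B «K2-LIT» (build stream 29),
h413 = `stmt-HodgeConjecture-24833`, line `K2_E3_EllipticInputs`, unit U12 «Characters», socket #11 road (11-SC), letter (SC-an), END-GAME MAP v5 (line lead
K2E3-p14 (g4) RULINGS #18 (R18-4), #19 (R19-2)∕(R19-6), `K2/STATUS.md` 2026-09-04T04:11:21Z «the final instantiation `hFCall` at `K = L_w` → K2E5-p04 (g3) by name when F3
lands»): piece (FC-10) — (FC) AT THE PLACE from ★ FC-8 `finConj`, the ELLIPTIC WEIGHT `ellWeightPlace_three` LETTER-FREE, and ROW 11 AT `N = 3` FOR SUPERCUSPIDAL CLASSES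
WITHOUT ANY NAMED LETTER.  2026-09-04.
-/
import Summits.HodgeConjecture.HodgeConjecture.Theorems.K2E3FinConjRankOne                            -- ★ (FC-8) F3b p857324 (K2E3-p23 g4): `finConj` — (FC) on the model `U(σ, Φ₃)(K)`, 𝔉-frame
import Summits.HodgeConjecture.HodgeConjecture.Theorems.K2E3EllWeightPlaceOfFinConj                     -- ★ (FC-9) p857240 (this seat): `ellWeightPlace_of_finConj` (+ ★ [M2a] place frame)
import Summits.HodgeConjecture.HodgeConjecture.Theorems.K2E3CharLocIntNearSemisimpleSupercuspidalThree  -- ★ (D56) p857198 (K2E3-p15 g3): row 11 at `N = 3` modulo «ELL-WEIGHT at the place»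
import HarnessLib

/-!
# h413 ∕ Track B «K2-LIT», line `K2_E3_EllipticInputs`, unit U12, road (11-SC), letter (SC-an) — (FC-10): THE FINITE-CONJUGATION-MEASURE STATEMENT AT THE PLACE `w ∣ v`,
# THE ELLIPTIC ORBITAL WEIGHT «ELL-WEIGHT at the place» LETTER-FREE, AND HARISH-CHANDRA'S THEOREM 16 FOR THE SUPERCUSPIDAL CLASSES OF `U₃(H)(L⁺_v)` (ROW 11 AT `N = 3`)
# WITH NO NAMED LETTER LEFT
# (Harish-Chandra 1970, Part VII §3 Theorem 16 p. 67; Harish-Chandra 1999, Theorem 16.1; Rogawski 1990, §12.2)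

Cell `pub/hodgecm-mathlib`, crux H413 = `stmt-HodgeConjecture-24833`, route of record `HCCMUnconditional`; dealer K2E3-plan (g3) (U12 ED. 11 2026-09-04T04:08:06Z: «NEXT U12 EDITION (ED. 12)
= the FC re-point: D56 ∘ FC-9 ∘ FC-8»), (SC-an) line lead K2E3-p14 (g4) (road «FC» = RULINGS #15–#19).  THEOREMS ONLY (no `def`, no `instance`, no `notation`, no `sorry`);
lane `--supports stmt-HodgeConjecture-24833 --as helper`, count-neutral.

§1 **`finConjPlace_of_finConj L w hw μ : ‹(FC) at (L, w, μ)›`** = ★ `K2E3FinConjRankOne.finConj` (K2E3-p23 (g4); over ★ FC-A, FC-B, FC-C∕5b∕5c, FC-5, FC-D, FC-6, FC-8a, F1–F3a and the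
unimodularity of `U(σ, Φ₃)(K)`) at `K := L_w`, `σ := σ_w = galAdicCompletionMap c hw` (`σ_w² = 1`, `|σ_w ·| = |·|` ★ [M2a]), a uniformiser `ϖ` of `L_w` (★ `exists_v_eq_exp_neg_one_adicCompletion`),
`J := Φ₃` (`rfl`), the instances `CharZero L_w`, `SecondCountableTopology ∕ LocallyCompactSpace U_w` (★ [M2a]).  §2 **`ellWeightPlace_three (L) {v} (w) (hw) [..] [..] (μ) [..] {S} (hS) :
‹«ELL-WEIGHT at the place»›`** := ★ (FC-9) `ellWeightPlace_of_finConj L w hw μ (finConjPlace_of_finConj L w hw μ) hS` — binder kinds = ★ (M5h‴)'s `hEW` ∕ ★ (D56)'s `hEW`, so it docks BARE.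
§3 **`charLocIntNearSemisimple_supercuspidal_three`** := ★ (D56) `charLocIntNearSemisimple_supercuspidal_three_of_ellWeightPlace ellWeightPlace_three` — U12 :265 with `N := 3`, statement
otherwise VERBATIM, NO hypothesis: for `H ∈ M₃(L)` hermitian with `det H ≠ 0`, `v` non-split, `μ` Haar, `c` a supercuspidal class of `U₃(H)(L⁺_v)` and `s` semisimple, the character of `c`
is a locally integrable function on a neighbourhood of `s` (Harish-Chandra's Theorem 16 for these groups and classes).

HONEST LABEL.  HC_CM is proved only modulo the 7 printed citations (2 remaining named inputs: hLiu418 = `stmt-HodgeConjecture-24832`, h413 = `stmt-HodgeConjecture-24833`)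
until rung 0 closes; count-neutral helper.  After this file the (SC-an) letter at `N = 3` and the supercuspidal branch of U12 row 11 at `N = 3` carry NO named letter (★ by name,
axioms TRIO); rows for `N ≠ 3`, the split∕residual branches of row 11 and the other U12 sockets are untouched.

## References
* [HarishChandra1970] Harish-Chandra (notes by G. van Dijk), *Harmonic Analysis on Reductive p-adic Groups*, LNM 162 (1970), Part V §2 Lemma 14 p. 52; Part VII §3
  Theorem 16 p. 67, pp. 70–73.
* [HarishChandra1999] Harish-Chandra (notes by S. DeBacker, P. J. Sally Jr.), *Admissible Invariant Distributions on Reductive p-adic Groups*, AMS ULS 16 (1999), Thm. 16.1 p. 77.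
* [Rogawski1990] J. D. Rogawski, *Automorphic Representations of Unitary Groups in Three Variables*, Ann. of Math. Stud. 123 (1990), §12.2 p. 173, §12.5 p. 182.
-/

set_option autoImplicit false
-- the mandated namespace repeats the single-problem summit's segment (`HodgeConjecture.HodgeConjecture`)
set_option linter.dupNamespace false

noncomputable section

open MeasureTheory Measure Set Filter Topology NumberField IsDedekindDomain
open scoped NNReal ENNReal Pointwise Matrix MatrixGroups WithZero
open ValuativeRel
open Literature.NumberTheory.Automorphic Literature.NumberTheory.Automorphic.UnitaryGroup Literature.NumberTheory.Rogawski1990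
open Literature.NumberTheory.Automorphic.UnitaryGroup.CotangentForms
open Literature.NumberTheory.GaloisRepresentations Literature.NumberTheory.GaloisRepresentations.IsNonarchimedeanLocalField

namespace Summit.HodgeConjecture.HodgeConjecture.Cruxes.H413.K2E3FinConjPlaceOfFinConj

/-! ## §1 (FC) at the place -/
set_option maxHeartbeats 800000 in -- long statement on the one-place carrier
/-- **(FC) AT THE PLACE `w ∣ v`** — for `U_w := U(σ_w, Φ₃)(L_w)` and any Haar `μ`: `∀ C ⊆ U_w` compact, `∀ β ∈ C_c(U_w, [0, Mb])` (`Mb < ⊤`):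
`∫⁻_{C ∩ Φ_β} ∫⁻ β(x g x⁻¹) dx dg < ⊤`, `Φ_β = {g | ∫⁻ β(xgx⁻¹) dx < ⊤}` — ★ FC-8 `finConj` at `K := L_w`, `σ := σ_w`, a uniformiser `ϖ`, `J := Φ₃`; the (FC-9) hypothesis `hFC` verbatim.
[cite: HarishChandra1970, Part V §2 Lemma 14 p. 52; Part VII §3 pp. 70–73] [cite: Rogawski1990, §12.5 p. 182] -/
theorem finConjPlace_of_finConj (L : Type) [Field L] [NumberField L] [IsCMField L] {v : HeightOneSpectrum (𝓞 ↥(maximalRealSubfield L))}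
    (w : UnitaryGroup.PlacesOver L v) (hw : IsCMField.complexConj L • w.1 = w.1)
    [MeasurableSpace ↥(unitaryGroupOfForm (galAdicCompletionMap (L := L) (IsCMField.complexConj L) hw) ((StdForm.antidiagonal 3).over (w.1.adicCompletion L)))]
    [BorelSpace ↥(unitaryGroupOfForm (galAdicCompletionMap (L := L) (IsCMField.complexConj L) hw) ((StdForm.antidiagonal 3).over (w.1.adicCompletion L)))]
    (μ : Measure ↥(unitaryGroupOfForm (galAdicCompletionMap (L := L) (IsCMField.complexConj L) hw) ((StdForm.antidiagonal 3).over (w.1.adicCompletion L)))) [μ.IsHaarMeasure] :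
    ∀ {C : Set ↥(unitaryGroupOfForm (galAdicCompletionMap (L := L) (IsCMField.complexConj L) hw) ((StdForm.antidiagonal 3).over (w.1.adicCompletion L)))}, IsCompact C →
      ∀ {β : ↥(unitaryGroupOfForm (galAdicCompletionMap (L := L) (IsCMField.complexConj L) hw) ((StdForm.antidiagonal 3).over (w.1.adicCompletion L))) → ℝ≥0∞},
        Continuous β → IsCompact (tsupport β) → ∀ {Mb : ℝ≥0∞}, Mb ≠ ⊤ → (∀ g, β g ≤ Mb) →
          ∫⁻ g in C ∩ {g | ∫⁻ x, β (x * g * x⁻¹) ∂μ < ⊤}, ∫⁻ x, β (x * g * x⁻¹) ∂μ ∂μ < ⊤ := by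
  intro C hC β hβ hβs Mb hMb hβM
  haveI : CharZero (w.1.adicCompletion L) := charZero_of_injective_algebraMap (algebraMap L (w.1.adicCompletion L)).injective
  haveI : SecondCountableTopology ↥(unitaryGroupOfForm (galAdicCompletionMap (L := L) (IsCMField.complexConj L) hw) ((StdForm.antidiagonal 3).over (w.1.adicCompletion L))) :=
    K2E3SupercuspModelFrameAtPlace.secondCountableTopology_unitaryGroupOfForm_adicCompletion L w _ _
  haveI : LocallyCompactSpace ↥(unitaryGroupOfForm (galAdicCompletionMap (L := L) (IsCMField.complexConj L) hw) ((StdForm.antidiagonal 3).over (w.1.adicCompletion L))) :=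
    K2E3SupercuspModelFrameAtPlace.locallyCompactSpace_unitaryGroupOfForm_adicCompletion L w hw _
  have hσσ : ∀ x, galAdicCompletionMap (L := L) (IsCMField.complexConj L) hw (galAdicCompletionMap (L := L) (IsCMField.complexConj L) hw x) = x :=
    galAdicCompletionMap_galAdicCompletionMap_of_smul_eq (IsCMField.complexConj L) w (IsCMField.complexConj_ne_one L) hw
  have hσv : ∀ x, Valued.v (galAdicCompletionMap (L := L) (IsCMField.complexConj L) hw x) = Valued.v x :=
    fun x => valued_galAdicCompletionMap (L := L) (IsCMField.complexConj L) hw x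
  obtain ⟨ϖ, hϖ⟩ := exists_v_eq_exp_neg_one_adicCompletion (E := L) w.1
  exact K2E3FinConjRankOne.finConj (galAdicCompletionMap (L := L) (IsCMField.complexConj L) hw) hσσ hσv hϖ rfl μ hC hβ hβs hMb hβM

/-! ## §2 «ELL-WEIGHT at the place», letter-free -/
set_option maxHeartbeats 800000 in -- long statement on the one-place carrier
/-- **«ELL-WEIGHT AT THE PLACE», LETTER-FREE** — for `U_w`, every Haar `μ` and every compact `S ⊆ U_w` there is `W_E : U_w → ℝ`, `0 ≤ W_E ∈ L¹_loc(μ)`, with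
`∫⁻ x, Θ (x γ x⁻¹) ∂μ ≤ W_E(γ) · Mb` for every regular `γ` with compact centraliser and every Borel `Θ ≤ Mb` vanishing off `S`: ★ (FC-9) `ellWeightPlace_of_finConj` fed with §1.
Binder kinds = ★ (M5h‴)'s ∕ ★ (D56)'s `hEW`, so `ellWeightPlace_three` docks bare. [cite: HarishChandra1970, Part V §2 Lemma 14 p. 52; Part VII §3 pp. 70–73] [cite: Rogawski1990, §12.5 p. 182] -/
theorem ellWeightPlace_three (L : Type) [Field L] [NumberField L] [IsCMField L] {v : HeightOneSpectrum (𝓞 ↥(maximalRealSubfield L))}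
    (w : UnitaryGroup.PlacesOver L v) (hw : IsCMField.complexConj L • w.1 = w.1)
    [MeasurableSpace ↥(unitaryGroupOfForm (galAdicCompletionMap (L := L) (IsCMField.complexConj L) hw) ((StdForm.antidiagonal 3).over (w.1.adicCompletion L)))]
    [BorelSpace ↥(unitaryGroupOfForm (galAdicCompletionMap (L := L) (IsCMField.complexConj L) hw) ((StdForm.antidiagonal 3).over (w.1.adicCompletion L)))]
    (μ : Measure ↥(unitaryGroupOfForm (galAdicCompletionMap (L := L) (IsCMField.complexConj L) hw) ((StdForm.antidiagonal 3).over (w.1.adicCompletion L)))) [μ.IsHaarMeasure]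
    {S : Set ↥(unitaryGroupOfForm (galAdicCompletionMap (L := L) (IsCMField.complexConj L) hw) ((StdForm.antidiagonal 3).over (w.1.adicCompletion L)))} (hS : IsCompact S) :
    ∃ W_E : ↥(unitaryGroupOfForm (galAdicCompletionMap (L := L) (IsCMField.complexConj L) hw) ((StdForm.antidiagonal 3).over (w.1.adicCompletion L))) → ℝ,
      LocallyIntegrable W_E μ ∧ (∀ g, 0 ≤ W_E g) ∧
      ∀ γ : ↥(unitaryGroupOfForm (galAdicCompletionMap (L := L) (IsCMField.complexConj L) hw) ((StdForm.antidiagonal 3).over (w.1.adicCompletion L))),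
        IsRegularElt (γ : GL (Fin 3) (w.1.adicCompletion L)) →
        IsCompact ((Subgroup.centralizer ({γ} : Set ↥(unitaryGroupOfForm (galAdicCompletionMap (L := L) (IsCMField.complexConj L) hw) ((StdForm.antidiagonal 3).over (w.1.adicCompletion L))))) :
            Set ↥(unitaryGroupOfForm (galAdicCompletionMap (L := L) (IsCMField.complexConj L) hw) ((StdForm.antidiagonal 3).over (w.1.adicCompletion L)))) →
          ∀ Θ : ↥(unitaryGroupOfForm (galAdicCompletionMap (L := L) (IsCMField.complexConj L) hw) ((StdForm.antidiagonal 3).over (w.1.adicCompletion L))) → ℝ≥0∞,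
            Measurable Θ → (∀ g, Θ g ≠ 0 → g ∈ S) → ∀ Mb : ℝ≥0∞, (∀ g, Θ g ≤ Mb) →
              ∫⁻ x, Θ (x * γ * x⁻¹) ∂μ ≤ ENNReal.ofReal (W_E γ) * Mb :=
  K2E3EllWeightPlaceOfFinConj.ellWeightPlace_of_finConj L w hw μ (finConjPlace_of_finConj L w hw μ) hS

/-! ## §3 Row 11 at `N = 3` for supercuspidal classes — no named letter -/
open scoped Classical in
/-- **HARISH-CHANDRA'S THEOREM 16 FOR THE SUPERCUSPIDAL CLASSES OF `U₃(H)(L⁺_v)`, `v` NON-SPLIT — NO NAMED LETTER.**  U12 :265 `charLocIntNearSemisimple_supercuspidal_of_sigSCan`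
with `N := 3`, statement otherwise VERBATIM: for `H ∈ M₃(L)` hermitian with `det H ≠ 0`, `v` non-split in `L/L⁺`, `μ` Haar on `U₃(H)(L⁺_v)`, `c` a supercuspidal class and `s`
semisimple, there are an open `U ∋ s` and `Θ ∈ L¹(U, μ)` with `tr c(f) = ∫ f·Θ dμ` for every Schwartz–Bruhat `f` supported in `U`.  ★ (D56) fed with §2.
[cite: HarishChandra1970, Part VII Thm 16 p. 67] [cite: HarishChandra1999, Thm 16.1 p. 77] [cite: Rogawski1990, §12.2 p. 173] -/
theorem charLocIntNearSemisimple_supercuspidal_three :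
    ∀ (L : Type) [Field L] [NumberField L] [IsCMField L] (H : Matrix (Fin 3) (Fin 3) L),
      (H.map (cmConjRingHom L))ᵀ = H → H.det ≠ 0 →
      ∀ (v : HeightOneSpectrum (𝓞 ↥(maximalRealSubfield L)))
        [MeasurableSpace ((UnitaryGroup.cmDatum L 3 H).Local v)] [BorelSpace ((UnitaryGroup.cmDatum L 3 H).Local v)]
        (μ : Measure ((UnitaryGroup.cmDatum L 3 H).Local v)) [μ.IsHaarMeasure]
        (c : IrrClass ((UnitaryGroup.cmDatum L 3 H).Local v)),
        (∀ w : PlacesOver L v, IsCMField.complexConj L • w.1 = w.1) → c.IsSupercuspidal →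
        ∀ s : (UnitaryGroup.cmDatum L 3 H).Local v,
          Module.End.IsSemisimple (Matrix.toLin' ((s.val : GL (Fin 3) (UnitaryGroup.LocalRing L v)).val : Matrix (Fin 3) (Fin 3) (UnitaryGroup.LocalRing L v))) →
          ∃ U : Set ((UnitaryGroup.cmDatum L 3 H).Local v), IsOpen U ∧ s ∈ U ∧
            ∃ Θ : (UnitaryGroup.cmDatum L 3 H).Local v → ℂ, IntegrableOn Θ U μ ∧
              ∀ f : (UnitaryGroup.cmDatum L 3 H).Local v → ℂ, f ∈ SchwartzBruhat ((UnitaryGroup.cmDatum L 3 H).Local v) → tsupport f ⊆ U →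
                c.smoothTrace μ f = ∫ g, f g * Θ g ∂μ :=
  K2E3CharLocIntNearSemisimpleSupercuspidalThree.charLocIntNearSemisimple_supercuspidal_three_of_ellWeightPlace ellWeightPlace_three

end Summit.HodgeConjecture.HodgeConjecture.Cruxes.H413.K2E3FinConjPlaceOfFinConj

end
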